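import Literature.NumberTheory.ComplexMultiplication.CMTypeRankPairFlipTransfer
import Literature.NumberTheory.ComplexMultiplication.CMTypeRankIrreducibleSlot
import Literature.NumberTheory.ComplexMultiplication.CMTypeRankTypeConjugation
import HarnessLib

/-!
# Two pair-flip slots with the same type stabiliser, II: the typed slots are isomorphic; hence two six-point
# pair-flip slots are rank-additive unless isomorphic

Sequel of `NumberTheory/ComplexMultiplication/CMTypeRankPairFlipTransfer` (same abstract setting: `G` acts on `X`
and `Y`, `ρ` a commuting fixed-point-free involution, CM types `Φ ⊆ X`, `Ψ ⊆ Y`, both slots of six points with PAIR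
FLIPS, and `Stab(Φ) = Stab(Ψ)`; there: the pointwise stabilisers of `X` and `Y` coincide and so do the pair-preserving
subgroups `A`).  Here:

* §1 **Flip patterns are single pairs** (`card_filter_flip_eq_two`, `exists_filter_flip_eq_pair`): a flip `φ_x` of
  the pair `{x, ρx} ⊆ X` acts on `Y` as the flip of exactly ONE pair.  (`φ_x ∈ A` acts on `Y` by sign changes; the
  number `d(a)` of points of `Y` moved by `a ∈ A` is additive modulo `4` (`card_filter_mul_mod_four`: symmetric
  differences, even intersections), conjugation-invariant, the product of the flips of the three pairs of `X` acts
  as `ρ`, so `3d ≡ 6 (mod 4)` and `0 < d < 6` force `d = 2`.)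
* §2 **`exists_equivariant_equiv_of_stabilizer_iff`** — THE TYPED SLOTS ARE ISOMORPHIC: there is a `G`-equivariant
  bijection `β : X ≃ Y` with `β(Φ) = Ψ` (send `x` to the point of the pair flipped by `φ_x` with the same
  membership; `β` commutes with the flips by a flip-correspondence induction, and with `Stab(Φ) = Stab(Ψ)`;
  `G = A · Stab` by `exists_pairPreserving_translate`).
* §3 Families (`CMTypeRankFamilies` setting, two slots `i₀ ≠ i₁` of six points with pair flips and transitive
  action): **`forall_map_slotExt_le_of_pairFlip_pair`** — if NO equivariant bijection `E_{i₀} ≃ E_{i₁}` carries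
  `Φ_{i₀}` onto `Φ_{i₁}`, then `U(Σ) = U(Φ_{i₀}) ⊕ U(Φ_{i₁})` (`Hg(A₀ × A₁) = Hg(A₀) × Hg(A₁)`): the stabilisers differ by
  §2, and stabiliser separation (`forall_map_slotExt_le_of_stabSep_pair`) applies because pair flips make
  `U(Φ_{i})` irreducible (`antiSpan_irreducible_of_pairFlip`); with the rank corollaries
  **`typeRank_sigmaType_add_card_eq_of_pairFlip_pair`**, **`typeRank_sigmaType_eq_of_pairFlip_pair`** (the pair is
  NONDEGENERATE — every pair-flip type being nondegenerate).

Use (CorCM, `GenericSexticThreefoldPairsHodge`): two NON-ISOGENOUS simple CM abelian threefolds whose sextic CM fields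
BOTH have Galois closure of degree `24` or `48` (equal or different fields) have `Hg(A₀ × A₁) = Hg(A₀) × Hg(A₁)`.
Theorems only: no definition, no named fact, no `sorry`.

## References

* [Gordon1999HodgeAVSurvey] B. B. Gordon, *A survey of the Hodge conjecture for abelian varieties*, §3 Theorem
  (proof), 7.4–7.7.
* [Dodson1984] B. Dodson, *The structure of Galois groups of CM-fields*, Trans. AMS 283 (1984), §1.1, §5.1.2.
* [Shimura1998] G. Shimura, *Abelian Varieties with Complex Multiplication and Modular Functions*, §8.2 Prop. 26.
-/

set_option autoImplicit false

namespace Literature.NumberTheory.ComplexMultiplication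

variable {G : Type*} [Group G]

/-! ### §0 Counting points moved by pair-preserving elements -/

section Count

variable {X : Type*} [MulAction G X] [Fintype X] [DecidableEq X] {ρ : G} {Φ : Set X}

omit [Fintype X] in
/-- `|S ∆ T| + 2|S ∩ T| = |S| + |T|`. [folklore] -/
private theorem card_symmDiff_add (s t : Finset X) :
    (symmDiff s t).card + 2 * (s ∩ t).card = s.card + t.card := by
  have h1 : symmDiff s t = s \ t ∪ t \ s := symmDiff_def s t
  have h2 : (s \ t ∪ t \ s).card = (s \ t).card + (t \ s).card := Finset.card_union_of_disjoint disjoint_sdiff_sdiff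
  have h3 := Finset.card_sdiff_add_card_inter s t
  have h4 := Finset.card_sdiff_add_card_inter t s
  rw [Finset.inter_comm t s] at h4
  rw [h1, h2]
  omega

omit [Fintype X] in
/-- **A `ρ`-stable finset has even cardinality** (`ρ` a fixed-point-free involution: the conjugate pairs of
embeddings). [cite: Dodson1984, §1.1] -/
theorem even_card_of_rho_stable (h : IsCMTypeWith ρ Φ) (S : Finset X) (hS : ∀ x ∈ S, ρ • x ∈ S) :
    Even S.card := by
  suffices key : ∀ (n : ℕ) (S : Finset X), (∀ x ∈ S, ρ • x ∈ S) → S.card = n → Even S.card from key _ S hS rfl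
  intro n
  induction n using Nat.strong_induction_on with
  | _ n ih =>
    intro S hS hn
    rcases S.eq_empty_or_nonempty with rfl | ⟨x, hx⟩
    · simp
    · have hρx : ρ • x ∈ S := hS x hx
      have hne : ρ • x ≠ x := h.rho_smul_ne x
      set S' := (S.erase x).erase (ρ • x) with hS'_def
      have hS' : ∀ y ∈ S', ρ • y ∈ S' := by
        intro y hy
        simp only [hS'_def, Finset.mem_erase] at hy ⊢
        refine ⟨fun hc => hy.2.1 ?_, fun hc => hy.1 ?_, hS y hy.2.2⟩
        · simpa [h.invol] using congrArg (ρ • ·) hc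
        · rw [← hc, h.invol]
      have hcard : S'.card + 2 = S.card := by
        rw [hS'_def, Finset.card_erase_of_mem (Finset.mem_erase.2 ⟨hne, hρx⟩), Finset.card_erase_of_mem hx]
        have := Finset.card_pos.2 ⟨x, hx⟩
        have h2 : 2 ≤ S.card := Finset.card_le_card (show ({x, ρ • x} : Finset X) ⊆ S by
          intro y hy; simp only [Finset.mem_insert, Finset.mem_singleton] at hy
          rcases hy with rfl | rfl <;> assumption) |> le_trans (by rw [Finset.card_pair hne.symm])
        omega
      have hev := ih S'.card (by omega) S' hS' rfl
      rw [← hcard]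
      exact hev.add (by decide)

/-- The points moved by a pair-preserving element form a `ρ`-stable finset. [cite: Dodson1984, §1.1] -/
theorem rho_smul_mem_filter_of_mem (h : IsCMTypeWith ρ Φ) {a : G} {x : X}
    (hx : x ∈ Finset.univ.filter fun x : X => a • x = ρ • x) :
    ρ • x ∈ Finset.univ.filter fun x : X => a • x = ρ • x := by
  simp only [Finset.mem_filter, Finset.mem_univ, true_and] at hx ⊢
  rw [h.comm, hx]

/-- **The points moved by a product of pair-preserving elements: the symmetric difference.** [cite: Dodson1984, §1.1] -/
theorem filter_mul_eq_symmDiff (h : IsCMTypeWith ρ Φ) {a b : G} (ha : ∀ x : X, a • x = x ∨ a • x = ρ • x)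
    (hb : ∀ x : X, b • x = x ∨ b • x = ρ • x) :
    (Finset.univ.filter fun x : X => (a * b) • x = ρ • x) =
      symmDiff (Finset.univ.filter fun x : X => a • x = ρ • x)
        (Finset.univ.filter fun x : X => b • x = ρ • x) := by
  ext x
  simp only [Finset.mem_filter, Finset.mem_univ, true_and, Finset.mem_symmDiff, mul_smul]
  have hρx : ρ • x ≠ x := h.rho_smul_ne x
  rcases hb x with hbx | hbx <;> rw [hbx]
  · constructor
    · intro hax; exact Or.inl ⟨hax, fun hc => hρx hc.symm⟩
    · rintro (⟨hax, -⟩ | ⟨hc, -⟩)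
      · exact hax
      · exact absurd hc.symm hρx
  · rw [h.comm]
    constructor
    · intro hax
      right
      refine ⟨rfl, fun hc => ?_⟩
      rw [hc, h.invol] at hax
      exact hρx hax.symm
    · rintro (⟨_, hc⟩ | ⟨-, hax⟩)
      · exact absurd rfl hc
      · rcases ha x with hax' | hax'
        · rw [hax']
        · exact absurd hax' hax

/-- **Modulo `4` the number of points moved is additive on pair-preserving elements** (the intersection of two
`ρ`-stable finsets is `ρ`-stable, hence even). [cite: Dodson1984, §1.1] -/
theorem card_filter_mul_mod_four (h : IsCMTypeWith ρ Φ) {a b : G} (ha : ∀ x : X, a • x = x ∨ a • x = ρ • x)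
    (hb : ∀ x : X, b • x = x ∨ b • x = ρ • x) :
    (Finset.univ.filter fun x : X => (a * b) • x = ρ • x).card % 4 =
      ((Finset.univ.filter fun x : X => a • x = ρ • x).card +
        (Finset.univ.filter fun x : X => b • x = ρ • x).card) % 4 := by
  rw [filter_mul_eq_symmDiff h ha hb]
  have h1 := card_symmDiff_add (Finset.univ.filter fun x : X => a • x = ρ • x)
    (Finset.univ.filter fun x : X => b • x = ρ • x)
  obtain ⟨m, hm⟩ := even_card_of_rho_stable h
    ((Finset.univ.filter fun x : X => a • x = ρ • x) ∩ (Finset.univ.filter fun x : X => b • x = ρ • x))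
    (fun x hx => Finset.mem_inter.2
      ⟨rho_smul_mem_filter_of_mem h (Finset.mem_inter.1 hx).1,
        rho_smul_mem_filter_of_mem h (Finset.mem_inter.1 hx).2⟩)
  omega

/-- **Conjugation does not change the number of points moved** (the moved set is translated by `g`).
[cite: Dodson1984, §1.1] -/
theorem card_filter_conj (h : IsCMTypeWith ρ Φ) (g a : G) :
    (Finset.univ.filter fun x : X => (g * a * g⁻¹) • x = ρ • x).card =
      (Finset.univ.filter fun x : X => a • x = ρ • x).card := by
  have key : (Finset.univ.filter fun x : X => (g * a * g⁻¹) • x = ρ • x) =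
      (Finset.univ.filter fun x : X => a • x = ρ • x).map ⟨(g • ·), MulAction.injective g⟩ := by
    ext x
    simp only [Finset.mem_filter, Finset.mem_univ, true_and, Finset.mem_map, Function.Embedding.coeFn_mk,
      mul_smul]
    constructor
    · intro hx
      refine ⟨g⁻¹ • x, ?_, smul_inv_smul g x⟩
      have := congrArg (g⁻¹ • ·) hx
      simp only [inv_smul_smul] at this
      rw [this, h.comm]
    · rintro ⟨z, hz, rfl⟩
      rw [inv_smul_smul, hz, h.comm]
  rw [key, Finset.card_map]

/-- The number of points moved is `|X|` iff the element acts as `ρ` on the slot. [cite: Dodson1984, §1.1] -/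
theorem card_filter_eq_card_iff (a : G) :
    (Finset.univ.filter fun x : X => a • x = ρ • x).card = Fintype.card X ↔ ∀ x : X, a • x = ρ • x := by
  rw [← Finset.card_univ, Finset.card_filter_eq_iff]
  simp

end Count

/-! ### §1 Three pairs; flips; the flip pattern on the other slot is a single pair -/

section ThreePairs

variable {X : Type*} [MulAction G X] [Fintype X] [DecidableEq X] {ρ : G} {Φ : Set X}

/-- **A six-point slot consists of three pairs**: given `x₁` there are `x₂`, `x₃` with `x₁, ρx₁, x₂, ρx₂, x₃, ρx₃`
pairwise distinct and exhausting `X`. [cite: Dodson1984, §1.1] -/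
theorem exists_three_pairs (h : IsCMTypeWith ρ Φ) (hcard : Fintype.card X = 6) (x₁ : X) :
    ∃ x₂ x₃ : X, x₂ ≠ x₁ ∧ x₂ ≠ ρ • x₁ ∧ x₃ ≠ x₁ ∧ x₃ ≠ ρ • x₁ ∧ x₃ ≠ x₂ ∧ x₃ ≠ ρ • x₂ ∧
      ∀ x : X, x = x₁ ∨ x = ρ • x₁ ∨ x = x₂ ∨ x = ρ • x₂ ∨ x = x₃ ∨ x = ρ • x₃ := by
  obtain ⟨e, he0, heρ⟩ := SexticB3.exists_equiv_cc hcard (MulAction.toPerm ρ)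
    (fun x => by simp [MulAction.toPerm_apply, h.invol]) (fun x => h.rho_smul_ne x) x₁
  replace heρ : ∀ x : X, e (ρ • x) = e x + 3 := fun x => by
    simpa [MulAction.toPerm_apply, SexticB3.cc_apply] using heρ x
  have key : ∀ i : Fin 6, i = 0 ∨ i = 0 + 3 ∨ i = 1 ∨ i = 1 + 3 ∨ i = 2 ∨ i = 2 + 3 := by decide
  refine ⟨e.symm 1, e.symm 2, ?_, ?_, ?_, ?_, ?_, ?_, fun x => ?_⟩
  · intro hc; have := congrArg e hc; rw [Equiv.apply_symm_apply, he0] at this; exact absurd this (by decide)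
  · intro hc; have := congrArg e hc; rw [Equiv.apply_symm_apply, heρ, he0] at this; exact absurd this (by decide)
  · intro hc; have := congrArg e hc; rw [Equiv.apply_symm_apply, he0] at this; exact absurd this (by decide)
  · intro hc; have := congrArg e hc; rw [Equiv.apply_symm_apply, heρ, he0] at this; exact absurd this (by decide)
  · intro hc; have := congrArg e hc; rw [Equiv.apply_symm_apply, Equiv.apply_symm_apply] at this
    exact absurd this (by decide)
  · intro hc; have := congrArg e hc; rw [Equiv.apply_symm_apply, heρ, Equiv.apply_symm_apply] at this
    exact absurd this (by decide)
  · have hx : ∀ i : Fin 6, e x = i → x = e.symm i := fun i hi => by rw [← hi, Equiv.symm_apply_apply]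
    have hx1 : x₁ = e.symm 0 := by rw [← he0, Equiv.symm_apply_apply]
    have hρs : ∀ i : Fin 6, ρ • e.symm i = e.symm (i + 3) := fun i =>
      e.injective (by rw [heρ, Equiv.apply_symm_apply, Equiv.apply_symm_apply])
    rcases key (e x) with hi | hi | hi | hi | hi | hi
    · exact Or.inl (by rw [hx _ hi, hx1])
    · exact Or.inr (Or.inl (by rw [hx _ hi, hx1, hρs]))
    · exact Or.inr (Or.inr (Or.inl (hx _ hi)))
    · exact Or.inr (Or.inr (Or.inr (Or.inl (by rw [hx _ hi, hρs]))))
    · exact Or.inr (Or.inr (Or.inr (Or.inr (Or.inl (hx _ hi)))))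
    · exact Or.inr (Or.inr (Or.inr (Or.inr (Or.inr (by rw [hx _ hi, hρs])))))

omit [Fintype X] in
/-- Two flips of the same pair agree on the slot. [cite: Dodson1984, §1.1] -/
theorem flip_smul_eq_flip_smul (h : IsCMTypeWith ρ Φ) {x : X} {φ φ' : G} (hφx : φ • x = ρ • x)
    (hφ : ∀ y : X, y ≠ x → y ≠ ρ • x → φ • y = y) (hφ'x : φ' • x = ρ • x)
    (hφ' : ∀ y : X, y ≠ x → y ≠ ρ • x → φ' • y = y) (y : X) : φ • y = φ' • y := by
  by_cases hyx : y = x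
  · rw [hyx, hφx, hφ'x]
  · by_cases hyρ : y = ρ • x
    · rw [hyρ, h.comm φ, hφx, h.comm φ', hφ'x]
    · rw [hφ y hyx hyρ, hφ' y hyx hyρ]

omit [Fintype X] [DecidableEq X] in
/-- A flip of the pair `{x, ρx}` is also a flip "at `ρx`". [cite: Dodson1984, §1.1] -/
theorem flip_rho (h : IsCMTypeWith ρ Φ) {x : X} {φ : G} (hφx : φ • x = ρ • x)
    (hφ : ∀ y : X, y ≠ x → y ≠ ρ • x → φ • y = y) :
    φ • (ρ • x) = ρ • ρ • x ∧ ∀ y : X, y ≠ ρ • x → y ≠ ρ • ρ • x → φ • y = y := by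
  refine ⟨by rw [h.comm, hφx], fun y hy1 hy2 => hφ y ?_ hy1⟩
  rw [h.invol] at hy2
  exact hy2

omit [Fintype X] [DecidableEq X] in
/-- **The conjugate `gφg⁻¹` of a flip at `x` is a flip at `gx`.** [cite: Dodson1984, §1.1] -/
theorem conj_flip (h : IsCMTypeWith ρ Φ) {x : X} {φ : G} (hφx : φ • x = ρ • x)
    (hφ : ∀ y : X, y ≠ x → y ≠ ρ • x → φ • y = y) (g : G) :
    (g * φ * g⁻¹) • (g • x) = ρ • g • x ∧
      ∀ y : X, y ≠ g • x → y ≠ ρ • g • x → (g * φ * g⁻¹) • y = y := by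
  refine ⟨by rw [mul_smul, mul_smul, inv_smul_smul, hφx, h.comm], fun y hy1 hy2 => ?_⟩
  rw [mul_smul, mul_smul, hφ (g⁻¹ • y) (fun hc => hy1 ?_) (fun hc => hy2 ?_), smul_inv_smul]
  · rw [← hc, smul_inv_smul]
  · rw [← h.comm, ← hc, smul_inv_smul]

omit [Fintype X] [DecidableEq X] in
/-- **The product of flips of the three pairs acts as `ρ`.** [cite: Dodson1984, §5.1.2] -/
theorem flips_mul_eq_rho (h : IsCMTypeWith ρ Φ) {x₁ x₂ x₃ : X} (h31 : x₃ ≠ x₁) (h31' : x₃ ≠ ρ • x₁)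
    (h32 : x₃ ≠ x₂) (h32' : x₃ ≠ ρ • x₂) (h21 : x₂ ≠ x₁) (h21' : x₂ ≠ ρ • x₁)
    (hall : ∀ x : X, x = x₁ ∨ x = ρ • x₁ ∨ x = x₂ ∨ x = ρ • x₂ ∨ x = x₃ ∨ x = ρ • x₃)
    {φ₁ φ₂ φ₃ : G} (h1 : φ₁ • x₁ = ρ • x₁) (h1' : ∀ y : X, y ≠ x₁ → y ≠ ρ • x₁ → φ₁ • y = y)
    (h2 : φ₂ • x₂ = ρ • x₂) (h2' : ∀ y : X, y ≠ x₂ → y ≠ ρ • x₂ → φ₂ • y = y)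
    (h3 : φ₃ • x₃ = ρ • x₃) (h3' : ∀ y : X, y ≠ x₃ → y ≠ ρ • x₃ → φ₃ • y = y) (x : X) :
    (φ₁ * (φ₂ * φ₃)) • x = ρ • x := by
  -- inequalities between the six points
  have i12 : x₁ ≠ x₂ := fun hc => h21 hc.symm
  have i12' : x₁ ≠ ρ • x₂ := fun hc => h21' (by rw [hc, h.invol])
  have i13 : x₁ ≠ x₃ := fun hc => h31 hc.symm
  have i13' : x₁ ≠ ρ • x₃ := fun hc => h31' (by rw [hc, h.invol])
  have i23 : x₂ ≠ x₃ := fun hc => h32 hc.symm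
  have i23' : x₂ ≠ ρ • x₃ := fun hc => h32' (by rw [hc, h.invol])
  have hρinj : ∀ {a b : X}, ρ • a = ρ • b → a = b := fun hab => by
    simpa [h.invol] using congrArg (ρ • ·) hab
  have r12 : ρ • x₁ ≠ x₂ := fun hc => i12' (by rw [← hc, h.invol])
  have r12' : ρ • x₁ ≠ ρ • x₂ := fun hc => i12 (hρinj hc)
  have r13 : ρ • x₁ ≠ x₃ := fun hc => i13' (by rw [← hc, h.invol])
  have r13' : ρ • x₁ ≠ ρ • x₃ := fun hc => i13 (hρinj hc)
  have r23 : ρ • x₂ ≠ x₃ := fun hc => i23' (by rw [← hc, h.invol])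
  have r23' : ρ • x₂ ≠ ρ • x₃ := fun hc => i23 (hρinj hc)
  have r21 : ρ • x₂ ≠ x₁ := fun hc => h21' (by rw [← hc, h.invol])
  have r21' : ρ • x₂ ≠ ρ • x₁ := fun hc => h21 (hρinj hc)
  have r31 : ρ • x₃ ≠ x₁ := fun hc => h31' (by rw [← hc, h.invol])
  have r31' : ρ • x₃ ≠ ρ • x₁ := fun hc => h31 (hρinj hc)
  have r32 : ρ • x₃ ≠ x₂ := fun hc => h32' (by rw [← hc, h.invol])
  have r32' : ρ • x₃ ≠ ρ • x₂ := fun hc => h32 (hρinj hc)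
  rw [mul_smul, mul_smul]
  rcases hall x with rfl | rfl | rfl | rfl | rfl | rfl
  · rw [h3' _ i13 i13', h2' _ i12 i12', h1]
  · rw [h3' _ r13 r13', h2' _ r12 r12', h.comm, h1]
  · rw [h3' _ i23 i23', h2, h.comm, h1' _ h21 h21']
  · rw [h3' _ r23 r23', h.comm, h2, h.invol, h1' _ h21 h21']
  · rw [h3, h.comm, h2' _ h32 h32', h.comm, h1' _ h31 h31']
  · rw [h.comm, h3, h.invol, h2' _ h32 h32', h1' _ h31 h31']

end ThreePairs

/-! ### §1 (continued) Two slots: the flip pattern on the other slot is a single pair -/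

section FlipPattern

variable {X Y : Type*} [MulAction G X] [MulAction G Y] [Fintype X] [DecidableEq X] [Fintype Y] [DecidableEq Y]
  {ρ : G} {Φ : Set X} {Ψ : Set Y}

/-- **A flip of a pair of `X` moves exactly two points of `Y`** (six-point pair-flip slots with `Stab(Φ) =
Stab(Ψ)`): the count `d` is the same for the flips of all three pairs (transitivity, conjugation), additive
modulo `4`, the product of the three flips acts as `ρ` (`d = 6`), and `0 < d < 6`.
[cite: Dodson1984, §5.1.2] [cite: Gordon1999HodgeAVSurvey, §3 Theorem (proof)] -/
theorem card_filter_flip_eq_two [MulAction.IsPretransitive G X] (hΦ : IsCMTypeWith ρ Φ) (hΨ : IsCMTypeWith ρ Ψ)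
    (hflipX : ∀ x : X, ∃ φ : G, φ • x = ρ • x ∧ ∀ y : X, y ≠ x → y ≠ ρ • x → φ • y = y)
    (hflipY : ∀ y : Y, ∃ φ : G, φ • y = ρ • y ∧ ∀ z : Y, z ≠ y → z ≠ ρ • y → φ • z = z)
    (hS : ∀ g : G, (∀ x : X, g • x ∈ Φ ↔ x ∈ Φ) ↔ ∀ y : Y, g • y ∈ Ψ ↔ y ∈ Ψ)
    (hcardX : Fintype.card X = 6) (hcardY : Fintype.card Y = 6) {x : X} {φ : G} (hφx : φ • x = ρ • x)
    (hφ : ∀ y : X, y ≠ x → y ≠ ρ • x → φ • y = y) :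
    (Finset.univ.filter fun y : Y => φ • y = ρ • y).card = 2 := by
  -- transfer tools
  have hXY : ∀ {g₁ g₂ : G}, (∀ x : X, g₁ • x = g₂ • x) → ∀ y : Y, g₁ • y = g₂ • y :=
    fun h12 => smul_eq_smul_of_forall_smul_eq hΨ hflipY hS h12
  have hAY : ∀ {a : G}, (∀ x : X, a • x = x ∨ a • x = ρ • x) → ∀ y : Y, a • y = y ∨ a • y = ρ • y :=
    fun ha => pairPreserving_of_pairPreserving hΦ hΨ hflipY hS hcardY ha
  -- three pairs of `X` and their flips
  obtain ⟨x₂, x₃, h21, h21', h31, h31', h32, h32', hall⟩ := exists_three_pairs hΦ hcardX x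
  obtain ⟨φ₂, h2, h2'⟩ := hflipX x₂
  obtain ⟨φ₃, h3, h3'⟩ := hflipX x₃
  have hA1 := pairPreserving_of_flip hΦ hφx hφ
  have hA2 := pairPreserving_of_flip hΦ h2 h2'
  have hA3 := pairPreserving_of_flip hΦ h3 h3'
  -- all flips move the same number of points of `Y`
  have hconj : ∀ {x' : X} {φ' : G}, φ' • x' = ρ • x' → (∀ y : X, y ≠ x' → y ≠ ρ • x' → φ' • y = y) →
      (Finset.univ.filter fun y : Y => φ' • y = ρ • y).card =
        (Finset.univ.filter fun y : Y => φ • y = ρ • y).card := by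
    intro x' φ' hφ'x hφ'
    obtain ⟨g, hg⟩ := MulAction.exists_smul_eq G x x'
    obtain ⟨hc1, hc2⟩ := conj_flip hΦ hφx hφ g
    rw [hg] at hc1 hc2
    have hagree : ∀ z : X, φ' • z = (g * φ * g⁻¹) • z := flip_smul_eq_flip_smul hΦ hφ'x hφ' hc1 hc2
    have hY := hXY hagree
    rw [← card_filter_conj hΨ g φ]
    congr 1
    ext y
    simp only [Finset.mem_filter, Finset.mem_univ, true_and, hY y]
  -- the product of the three flips acts as `ρ` on `X`, hence on `Y`
  have hP : ∀ y : Y, (φ * (φ₂ * φ₃)) • y = ρ • y :=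
    hXY fun z => flips_mul_eq_rho hΦ h31 h31' h32 h32' h21 h21' hall hφx hφ h2 h2' h3 h3' z
  have hP6 : (Finset.univ.filter fun y : Y => (φ * (φ₂ * φ₃)) • y = ρ • y).card = 6 := by
    rw [← hcardY]; exact (card_filter_eq_card_iff _).2 hP
  -- additivity modulo `4`
  have hm1 := card_filter_mul_mod_four hΨ (hAY hA1) (pairPreserving_mul hΨ (hAY hA2) (hAY hA3))
  have hm2 := card_filter_mul_mod_four hΨ (hAY hA2) (hAY hA3)
  rw [hP6] at hm1
  rw [hconj h2 h2', hconj h3 h3'] at hm2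
  -- `0 < d < 6`
  set d := (Finset.univ.filter fun y : Y => φ • y = ρ • y).card with hd
  have hd6 : d ≤ 6 := by rw [hd, ← hcardY, ← Finset.card_univ]; exact Finset.card_filter_le _ _
  have hd0 : d ≠ 0 := by
    intro hd0
    rw [hd, Finset.card_eq_zero, Finset.filter_eq_empty_iff] at hd0
    have hfix : ∀ y : Y, φ • y = y := fun y => ((hAY hA1) y).resolve_right (hd0 (Finset.mem_univ y))
    have := forall_smul_eq_of_forall_smul_eq hΦ hflipX hS hfix x
    rw [hφx] at this
    exact hΦ.rho_smul_ne x this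
  have hd6' : d ≠ 6 := by
    intro hd6'
    rw [hd, ← hcardY, card_filter_eq_card_iff] at hd6'
    have := forall_smul_eq_of_forall_smul_eq hΦ hflipX hS (n := ρ⁻¹ * φ)
      (fun y => by rw [mul_smul, hd6', inv_smul_smul]) x₂
    rw [mul_smul, hφ x₂ h21 h21', inv_smul_eq_iff] at this
    exact hΦ.rho_smul_ne x₂ this.symm
  omega

/-- **The flip pattern is a single pair**: a flip of `{x, ρx} ⊆ X` acts on `Y` as the flip of one pair `{y, ρy}`.
[cite: Dodson1984, §5.1.2] -/
theorem exists_filter_flip_eq_pair [MulAction.IsPretransitive G X] (hΦ : IsCMTypeWith ρ Φ)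
    (hΨ : IsCMTypeWith ρ Ψ)
    (hflipX : ∀ x : X, ∃ φ : G, φ • x = ρ • x ∧ ∀ y : X, y ≠ x → y ≠ ρ • x → φ • y = y)
    (hflipY : ∀ y : Y, ∃ φ : G, φ • y = ρ • y ∧ ∀ z : Y, z ≠ y → z ≠ ρ • y → φ • z = z)
    (hS : ∀ g : G, (∀ x : X, g • x ∈ Φ ↔ x ∈ Φ) ↔ ∀ y : Y, g • y ∈ Ψ ↔ y ∈ Ψ)
    (hcardX : Fintype.card X = 6) (hcardY : Fintype.card Y = 6) {x : X} {φ : G} (hφx : φ • x = ρ • x)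
    (hφ : ∀ y : X, y ≠ x → y ≠ ρ • x → φ • y = y) :
    ∃ y : Y, ∀ z : Y, φ • z = ρ • z ↔ (z = y ∨ z = ρ • y) := by
  have h2 := card_filter_flip_eq_two hΦ hΨ hflipX hflipY hS hcardX hcardY hφx hφ
  obtain ⟨y, hy⟩ : ∃ y, y ∈ Finset.univ.filter fun y : Y => φ • y = ρ • y :=
    Finset.card_pos.1 (by rw [h2]; norm_num)
  have hρy := rho_smul_mem_filter_of_mem hΨ hy
  have hsub : ({y, ρ • y} : Finset Y) ⊆ Finset.univ.filter fun y : Y => φ • y = ρ • y := by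
    intro z hz
    simp only [Finset.mem_insert, Finset.mem_singleton] at hz
    rcases hz with rfl | rfl
    · exact hy
    · exact hρy
  have heq := Finset.eq_of_subset_of_card_le hsub (by rw [h2, Finset.card_pair (hΨ.rho_smul_ne y).symm])
  refine ⟨y, fun z => ?_⟩
  have := Finset.ext_iff.1 heq z
  simp only [Finset.mem_insert, Finset.mem_singleton, Finset.mem_filter, Finset.mem_univ, true_and] at this
  exact this.symm

end FlipPattern

/-! ### §2 The typed slots are isomorphic -/

section Iso

variable {X Y : Type*} [MulAction G X] [MulAction G Y] [Fintype X] [DecidableEq X] [Fintype Y] [DecidableEq Y]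
  {ρ : G} {Φ : Set X} {Ψ : Set Y}

omit [Fintype Y] [DecidableEq Y] in
/-- `ρy ∈ Ψ ↔ y ∉ Ψ` for a CM type. [folklore] -/
private theorem rho_smul_mem_iff (h : IsCMTypeWith ρ Ψ) (y : Y) : ρ • y ∈ Ψ ↔ y ∉ Ψ := by
  rw [h.mem_iff (ρ • y), h.invol]

/-- **Equal type stabilisers in two six-point pair-flip slots force a typed isomorphism.**  Let `G` act
transitively on `X` and on `Y` (`|X| = |Y| = 6`), `ρ ∈ G` a commuting fixed-point-free involution on both, both slots
with pair flips, and `Φ ⊆ X`, `Ψ ⊆ Y` CM types with the SAME stabiliser: `gΦ = Φ ⟺ gΨ = Ψ` for all `g ∈ G`.  Then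
there is a `G`-equivariant bijection `β : X ≃ Y` with `β(x) ∈ Ψ ⟺ x ∈ Φ`.  For CM fields (`G = Aut(ℂ)`,
`X = Hom(K₀, ℂ)`, `Y = Hom(K₁, ℂ)`): the two CM types are equivalent along a field isomorphism `K₀ ≅ K₁`, so the
abelian varieties are isogenous (Shimura); primitive types with the same reflex FIELD need not be equivalent in
general — the pair flips are essential. [cite: Gordon1999HodgeAVSurvey, §3 Theorem (proof)]
[cite: Shimura1998, §8.2 Prop. 26] [cite: Dodson1984, §5.1.2] -/
theorem exists_equivariant_equiv_of_stabilizer_iff [MulAction.IsPretransitive G X]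
    [MulAction.IsPretransitive G Y] (hΦ : IsCMTypeWith ρ Φ) (hΨ : IsCMTypeWith ρ Ψ)
    (hflipX : ∀ x : X, ∃ φ : G, φ • x = ρ • x ∧ ∀ y : X, y ≠ x → y ≠ ρ • x → φ • y = y)
    (hflipY : ∀ y : Y, ∃ φ : G, φ • y = ρ • y ∧ ∀ z : Y, z ≠ y → z ≠ ρ • y → φ • z = z)
    (hS : ∀ g : G, (∀ x : X, g • x ∈ Φ ↔ x ∈ Φ) ↔ ∀ y : Y, g • y ∈ Ψ ↔ y ∈ Ψ)
    (hcardX : Fintype.card X = 6) (hcardY : Fintype.card Y = 6) :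
    ∃ β : X ≃ Y, (∀ (g : G) (x : X), β (g • x) = g • β x) ∧ ∀ x : X, β x ∈ Ψ ↔ x ∈ Φ := by
  classical
  -- transfer tools
  have hXY : ∀ {g₁ g₂ : G}, (∀ x : X, g₁ • x = g₂ • x) → ∀ y : Y, g₁ • y = g₂ • y :=
    fun h12 => smul_eq_smul_of_forall_smul_eq hΨ hflipY hS h12
  have hYX : ∀ {g₁ g₂ : G}, (∀ y : Y, g₁ • y = g₂ • y) → ∀ x : X, g₁ • x = g₂ • x :=
    fun h12 => smul_eq_smul_of_forall_smul_eq hΦ hflipX (fun g => (hS g).symm) h12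
  have hAY : ∀ {a : G}, (∀ x : X, a • x = x ∨ a • x = ρ • x) → ∀ y : Y, a • y = y ∨ a • y = ρ • y :=
    fun ha => pairPreserving_of_pairPreserving hΦ hΨ hflipY hS hcardY ha
  -- flips and their one-pair patterns on `Y`
  choose fl hflx hfl using hflipX
  have hflipX : ∀ x : X, ∃ φ : G, φ • x = ρ • x ∧ ∀ y : X, y ≠ x → y ≠ ρ • x → φ • y = y :=
    fun x => ⟨fl x, hflx x, hfl x⟩
  have hpair : ∀ x : X, ∃ y : Y, ∀ z : Y, fl x • z = ρ • z ↔ (z = y ∨ z = ρ • y) := fun x =>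
    exists_filter_flip_eq_pair hΦ hΨ hflipX hflipY hS hcardX hcardY (hflx x) (hfl x)
  choose yf hyf using hpair
  -- the map
  set β₀ : X → Y := fun x => if (x ∈ Φ ↔ yf x ∈ Ψ) then yf x else ρ • yf x with hβ₀_def
  have hβflip : ∀ x, fl x • β₀ x = ρ • β₀ x := by
    intro x
    by_cases hc : (x ∈ Φ ↔ yf x ∈ Ψ)
    · simp only [hβ₀_def, hc, if_true]; exact (hyf x (yf x)).2 (Or.inl rfl)
    · simp only [hβ₀_def, hc, if_false]; exact (hyf x (ρ • yf x)).2 (Or.inr rfl)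
  have hβmem : ∀ x, β₀ x ∈ Ψ ↔ x ∈ Φ := by
    intro x
    by_cases hc : (x ∈ Φ ↔ yf x ∈ Ψ)
    · simp only [hβ₀_def, hc, if_true]
    · simp only [hβ₀_def, hc, if_false, rho_smul_mem_iff hΨ]
      tauto
  have hβfilter : ∀ (x : X) (z : Y), fl x • z = ρ • z ↔ (z = β₀ x ∨ z = ρ • β₀ x) := by
    intro x z
    rw [hyf x z]
    by_cases hc : (x ∈ Φ ↔ yf x ∈ Ψ)
    · simp only [hβ₀_def, hc, if_true]
    · simp only [hβ₀_def, hc, if_false, hΨ.invol]; tauto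
  -- a flip fixes the points of `Y` outside its pattern
  have hfix : ∀ (x : X) (z : Y), z ≠ β₀ x → z ≠ ρ • β₀ x → fl x • z = z := by
    intro x z h1 h2
    rcases hAY (pairPreserving_of_flip hΦ (hflx x) (hfl x)) z with hz | hz
    · exact hz
    · exact absurd ((hβfilter x z).1 hz) (by tauto)
  -- `β₀ (ρ x) = ρ β₀ x`
  have hβρ : ∀ x, β₀ (ρ • x) = ρ • β₀ x := by
    intro x
    obtain ⟨hr1, hr2⟩ := flip_rho hΦ (hflx x) (hfl x)
    have hagree : ∀ z : X, fl (ρ • x) • z = fl x • z := flip_smul_eq_flip_smul hΦ (hflx _) (hfl _) hr1 hr2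
    have hY := hXY hagree
    have hmemρ : β₀ (ρ • x) ∈ Ψ ↔ β₀ x ∉ Ψ := by rw [hβmem, hβmem, rho_smul_mem_iff hΦ]
    have hin : fl x • β₀ (ρ • x) = ρ • β₀ (ρ • x) := by rw [← hY]; exact hβflip (ρ • x)
    rcases (hβfilter x _).1 hin with hc | hc
    · rw [hc] at hmemρ; exact absurd hmemρ (by tauto)
    · exact hc
  -- injectivity
  have hβinj : Function.Injective β₀ := by
    intro x x' hxx'
    by_contra hne
    -- `fl x` and `fl x'` have the same pattern on `Y`, so `fl x * fl x'` fixes `Y`, hence `X`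
    have hsame : ∀ z : Y, fl x • z = ρ • z ↔ fl x' • z = ρ • z := fun z => by
      rw [hβfilter x z, hβfilter x' z, hxx']
    have hprod : ∀ z : Y, (fl x * fl x') • z = z := by
      intro z
      rw [mul_smul]
      rcases hAY (pairPreserving_of_flip hΦ (hflx x') (hfl x')) z with hz | hz
      · rw [hz]
        rcases hAY (pairPreserving_of_flip hΦ (hflx x) (hfl x)) z with hz' | hz'
        · exact hz'
        · exact absurd ((hsame z).1 hz') (by rw [hz]; exact fun hc => hΨ.rho_smul_ne z hc.symm)
      · rw [hz, hΨ.comm, (hsame z).2 hz, hΨ.invol]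
    have hX := forall_smul_eq_of_forall_smul_eq hΦ hflipX hS hprod x'
    rw [mul_smul, hflx x'] at hX
    -- so `fl x` moves `ρ x'`: `x' ∈ {x, ρ x}`
    have hx' : x' = x ∨ x' = ρ • x := by
      by_contra hc
      push Not at hc
      have h1 : ρ • x' ≠ x := fun h' => hc.2 (by rw [← h', hΦ.invol])
      have h2 : ρ • x' ≠ ρ • x := fun h' => hc.1 (by simpa [hΦ.invol] using congrArg (ρ • ·) h')
      rw [hfl x (ρ • x') h1 h2] at hX
      exact hΦ.rho_smul_ne x' hX
    rcases hx' with hx' | hx'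
    · exact hne hx'.symm
    · rw [hx', hβρ] at hxx'
      exact hΨ.rho_smul_ne (β₀ x) hxx'.symm
  have hβbij : Function.Bijective β₀ :=
    (Fintype.bijective_iff_injective_and_card β₀).2 ⟨hβinj, by rw [hcardX, hcardY]⟩
  -- flip correspondence: a pair-preserving `b` moves `x` iff it moves `β₀ x`
  have FC : ∀ (n : ℕ) (b : G), (∀ x : X, b • x = x ∨ b • x = ρ • x) →
      (Finset.univ.filter fun x : X => b • x = ρ • x).card = n →
      ∀ x : X, b • x = ρ • x ↔ b • β₀ x = ρ • β₀ x := by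
    intro n
    induction n using Nat.strong_induction_on with
    | _ n ih =>
      intro b hb hn x
      by_cases hb0 : ∀ x' : X, b • x' = x'
      · have hbY : ∀ y : Y, b • y = y := fun y => by
          simpa using hXY (g₁ := b) (g₂ := 1) (fun x' => by rw [hb0, one_smul]) y
        rw [hb0, hbY]
        exact ⟨fun hc => absurd hc.symm (hΦ.rho_smul_ne x), fun hc => absurd hc.symm (hΨ.rho_smul_ne _)⟩
      push Not at hb0
      obtain ⟨x₀, hx₀⟩ := hb0
      have hbx₀ : b • x₀ = ρ • x₀ := (hb x₀).resolve_left hx₀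
      set b' := b * fl x₀ with hb'_def
      have hb' : ∀ x' : X, b' • x' = x' ∨ b' • x' = ρ • x' :=
        pairPreserving_mul hΦ hb (pairPreserving_of_flip hΦ (hflx x₀) (hfl x₀))
      have hb'x₀ : b' • x₀ = x₀ := by rw [hb'_def, mul_smul, hflx, hΦ.comm, hbx₀, hΦ.invol]
      have hb'ρx₀ : b' • (ρ • x₀) = ρ • x₀ := by rw [hb'_def, mul_smul, hΦ.comm, hflx, hΦ.invol, hbx₀]
      have hb'x : ∀ x' : X, x' ≠ x₀ → x' ≠ ρ • x₀ → b' • x' = b • x' := fun x' h1 h2 => by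
        rw [hb'_def, mul_smul, hfl x₀ x' h1 h2]
      have hlt : (Finset.univ.filter fun x : X => b' • x = ρ • x).card < n := by
        rw [← hn]
        apply Finset.card_lt_card
        rw [Finset.ssubset_iff_of_subset]
        · refine ⟨x₀, by simp [hbx₀], ?_⟩
          simp only [Finset.mem_filter, Finset.mem_univ, true_and, hb'x₀]
          exact fun hc => hΦ.rho_smul_ne x₀ hc.symm
        · intro x' hx'
          simp only [Finset.mem_filter, Finset.mem_univ, true_and] at hx' ⊢
          by_cases h1 : x' = x₀
          · rw [h1, hb'x₀] at hx'; exact absurd hx'.symm (hΦ.rho_smul_ne x₀)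
          · by_cases h2 : x' = ρ • x₀
            · rw [h2, hb'ρx₀, hΦ.invol] at hx'; exact absurd hx' (hΦ.rho_smul_ne x₀)
            · rwa [hb'x x' h1 h2] at hx'
      have IH := ih _ hlt b' hb' rfl
      -- `b` moves `β₀ x₀`
      have hbβ₀ : b • β₀ x₀ = ρ • β₀ x₀ := by
        have h1 : ¬(b' • β₀ x₀ = ρ • β₀ x₀) := fun hc =>
          hΦ.rho_smul_ne x₀ (((IH x₀).2 hc).symm.trans hb'x₀)
        rw [hb'_def, mul_smul, hβflip, hΨ.comm] at h1
        rcases hAY hb (β₀ x₀) with hc | hc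
        · exact absurd (by rw [hc]) h1
        · exact hc
      by_cases h1 : x = x₀
      · rw [h1]; exact ⟨fun _ => hbβ₀, fun _ => hbx₀⟩
      · by_cases h2 : x = ρ • x₀
        · have e1 : b • x = ρ • x := by rw [h2, hΦ.comm, hbx₀, hΦ.invol]
          have e2 : b • β₀ x = ρ • β₀ x := by rw [h2, hβρ, hΨ.comm, hbβ₀, hΨ.invol]
          exact ⟨fun _ => e2, fun _ => e1⟩
        · -- away from the pair of `x₀`
          have hβ1 : β₀ x ≠ β₀ x₀ := fun hc => h1 (hβinj hc)
          have hβ2 : β₀ x ≠ ρ • β₀ x₀ := fun hc => h2 (hβinj (by rw [hc, hβρ]))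
          rw [← hb'x x h1 h2, IH x, hb'_def, mul_smul, hfix x₀ (β₀ x) hβ1 hβ2]
  -- equivariance
  refine ⟨Equiv.ofBijective β₀ hβbij, fun g x => ?_, fun x => hβmem x⟩
  simp only [Equiv.ofBijective_apply]
  obtain ⟨a, haP, ha⟩ := exists_pairPreserving_translate hΦ hflipX (hΦ.preimage_smul g)
  simp only [Set.mem_setOf_eq] at ha
  have hs : ∀ x' : X, (g * a⁻¹) • x' ∈ Φ ↔ x' ∈ Φ := fun x' => by
    have := ha (a⁻¹ • x')
    rw [smul_inv_smul] at this
    rw [mul_smul]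
    exact this.symm
  have hsΨ := (hS _).1 hs
  have hmem : g • β₀ x ∈ Ψ ↔ g • x ∈ Φ := by
    have h1 : g • β₀ x ∈ Ψ ↔ a • β₀ x ∈ Ψ := by
      have := hsΨ (a • β₀ x)
      rwa [mul_smul, inv_smul_smul] at this
    have h2 : a • β₀ x ∈ Ψ ↔ a • x ∈ Φ := by
      rcases haP x with hax | hax
      · have hne : ¬(a • β₀ x = ρ • β₀ x) := fun hc =>
          hΦ.rho_smul_ne x (((FC _ a haP rfl x).2 hc).symm.trans hax)
        have haβ : a • β₀ x = β₀ x := (hAY haP (β₀ x)).resolve_right hne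
        rw [haβ, hax]
        exact hβmem x
      · rw [(FC _ a haP rfl x).1 hax, hax, rho_smul_mem_iff hΨ, rho_smul_mem_iff hΦ, hβmem]
    rw [h1, h2, ha x]
  -- `g β₀ x` lies in the pattern of the flip at `g x`
  have hpat : fl (g • x) • (g • β₀ x) = ρ • g • β₀ x := by
    obtain ⟨hc1, hc2⟩ := conj_flip hΦ (hflx x) (hfl x) g
    have hagree : ∀ z : X, fl (g • x) • z = (g * fl x * g⁻¹) • z := flip_smul_eq_flip_smul hΦ (hflx _) (hfl _) hc1 hc2
    rw [hXY hagree, mul_smul, mul_smul, inv_smul_smul, hβflip, hΨ.comm]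
  rcases (hβfilter (g • x) (g • β₀ x)).1 hpat with hc | hc
  · exact hc.symm
  · exfalso
    have h1 := hβmem (g • x)
    rw [hc, rho_smul_mem_iff hΨ] at hmem
    tauto

end Iso

/-! ### §3 Families: two six-point pair-flip slots are additive unless isomorphic -/

section Family

variable {I : Type*} {E : I → Type*} [∀ i, MulAction G (E i)] [∀ i, Fintype (E i)] [∀ i, DecidableEq (E i)]
  [DecidableEq I] [Fintype I] {ρ : G} {Φ : ∀ i, Set (E i)}

/-- **Two six-point pair-flip slots whose typed slots are NOT isomorphic are additive**: `ext_i U(Φ_i) ≤ U(Σ)` for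
both slots, i.e. `U(Σ) = U(Φ_{i₀}) ⊕ U(Φ_{i₁})` (`Hg(A₀ × A₁) = Hg(A₀) × Hg(A₁)`).  The stabilisers of `Φ_{i₀}` and
`Φ_{i₁}` differ (`exists_equivariant_equiv_of_stabilizer_iff`), so some `g` stabilises one type and moves the other;
`U` of the moved slot is irreducible by pair flips; stabiliser separation. [cite: Gordon1999HodgeAVSurvey, §3 Theorem]
[cite: Dodson1984, §5.1.2] -/
theorem forall_map_slotExt_le_of_pairFlip_pair [∀ i, MulAction.IsPretransitive G (E i)]
    (h : ∀ i, IsCMTypeWith ρ (Φ i)) {i₀ i₁ : I} (hI : ∀ j, j = i₀ ∨ j = i₁) (h01 : i₀ ≠ i₁)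
    (hflip : ∀ (i : I) (x : E i), ∃ φ : G, φ • x = ρ • x ∧ ∀ y : E i, y ≠ x → y ≠ ρ • x → φ • y = y)
    (hcard : ∀ i, Fintype.card (E i) = 6)
    (hne : ∀ β : E i₀ ≃ E i₁, (∀ (g : G) (x : E i₀), β (g • x) = g • β x) →
      ∃ x : E i₀, ¬(β x ∈ Φ i₁ ↔ x ∈ Φ i₀)) :
    ∀ i, (antiSpan G (Φ i)).map (slotExt i) ≤ antiSpan G (sigmaType Φ) := by
  haveI : ∀ i, Nonempty (E i) := fun i => Fintype.card_pos_iff.1 (by rw [hcard]; norm_num)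
  have hirr : ∀ i (W : Submodule ℚ (E i → ℚ)), W ≤ antiSpan G (Φ i) → W ≠ ⊥ →
      (∀ (k : G) (f : E i → ℚ), f ∈ W → (fun y => f (k • y)) ∈ W) → W = antiSpan G (Φ i) :=
    fun i => antiSpan_irreducible_of_pairFlip (h i) (hflip i)
  by_cases hst : ∀ g : G, (∀ x : E i₀, g • x ∈ Φ i₀ ↔ x ∈ Φ i₀) ↔ ∀ y : E i₁, g • y ∈ Φ i₁ ↔ y ∈ Φ i₁
  · obtain ⟨β, hβ, hβmem⟩ := exists_equivariant_equiv_of_stabilizer_iff (h i₀) (h i₁) (hflip i₀) (hflip i₁)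
      hst (hcard i₀) (hcard i₁)
    obtain ⟨x, hx⟩ := hne β hβ
    exact absurd (hβmem x) hx
  rw [not_forall] at hst
  obtain ⟨g, hg⟩ := hst
  by_cases hg0 : ∀ x : E i₀, g • x ∈ Φ i₀ ↔ x ∈ Φ i₀
  · -- `g` stabilises `Φ_{i₀}` and moves `Φ_{i₁}`
    have hg1 : ∃ y : E i₁, ¬(g • y ∈ Φ i₁ ↔ y ∈ Φ i₁) := by
      by_contra hc; push Not at hc; exact hg ⟨fun _ => hc, fun _ => hg0⟩
    refine forall_map_slotExt_le_of_stabSep_pair i₁ hI h01 (g := g) (fun i hi => ?_) hg1 (hirr i₁)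
    rcases hI i with rfl | rfl
    · exact hg0
    · exact absurd rfl hi
  · -- `g` stabilises `Φ_{i₁}` and moves `Φ_{i₀}`
    have hg1 : ∀ y : E i₁, g • y ∈ Φ i₁ ↔ y ∈ Φ i₁ := by
      by_contra hc; exact hg ⟨fun h0 => absurd h0 hg0, fun h1 => absurd h1 hc⟩
    have hg0' : ∃ x : E i₀, ¬(g • x ∈ Φ i₀ ↔ x ∈ Φ i₀) := by
      by_contra hc; push Not at hc; exact hg0 hc
    refine forall_map_slotExt_le_of_stabSep_pair i₀ (fun j => (hI j).symm) (Ne.symm h01) (g := g)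
      (fun i hi => ?_) hg0' (hirr i₀)
    rcases hI i with rfl | rfl
    · exact absurd rfl hi
    · exact hg1

variable [Nonempty I]

/-- **Rank additivity for two six-point pair-flip slots that are not isomorphic as typed slots**:
`rank(Φ₀, Φ₁) + 2 = rank Φ₀ + rank Φ₁ + 1`. [cite: Gordon1999HodgeAVSurvey, §3 Theorem (1) and 7.7] -/
theorem typeRank_sigmaType_add_card_eq_of_pairFlip_pair [∀ i, MulAction.IsPretransitive G (E i)]
    (h : ∀ i, IsCMTypeWith ρ (Φ i)) {i₀ i₁ : I} (hI : ∀ j, j = i₀ ∨ j = i₁) (h01 : i₀ ≠ i₁)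
    (hflip : ∀ (i : I) (x : E i), ∃ φ : G, φ • x = ρ • x ∧ ∀ y : E i, y ≠ x → y ≠ ρ • x → φ • y = y)
    (hcard : ∀ i, Fintype.card (E i) = 6)
    (hne : ∀ β : E i₀ ≃ E i₁, (∀ (g : G) (x : E i₀), β (g • x) = g • β x) →
      ∃ x : E i₀, ¬(β x ∈ Φ i₁ ↔ x ∈ Φ i₀)) :
    typeRank G (sigmaType Φ) + Fintype.card I = (∑ i, typeRank G (Φ i)) + 1 :=
  haveI : ∀ i, Nonempty (E i) := fun i => Fintype.card_pos_iff.1 (by rw [hcard]; norm_num)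
  typeRank_sigmaType_add_card_eq_of_forall_map_le h
    (forall_map_slotExt_le_of_pairFlip_pair h hI h01 hflip hcard hne)

/-- **Two six-point pair-flip slots that are not isomorphic as typed slots form a NONDEGENERATE family**
(`rank(Φ₀, Φ₁) = 6 + 1`: every pair-flip type is nondegenerate and the family is additive).
[cite: Gordon1999HodgeAVSurvey, §3 Theorem and 7.5] [cite: Dodson1984, §5.1.2] -/
theorem typeRank_sigmaType_eq_of_pairFlip_pair [∀ i, MulAction.IsPretransitive G (E i)]
    (h : ∀ i, IsCMTypeWith ρ (Φ i)) {i₀ i₁ : I} (hI : ∀ j, j = i₀ ∨ j = i₁) (h01 : i₀ ≠ i₁)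
    (hflip : ∀ (i : I) (x : E i), ∃ φ : G, φ • x = ρ • x ∧ ∀ y : E i, y ≠ x → y ≠ ρ • x → φ • y = y)
    (hcard : ∀ i, Fintype.card (E i) = 6)
    (hne : ∀ β : E i₀ ≃ E i₁, (∀ (g : G) (x : E i₀), β (g • x) = g • β x) →
      ∃ x : E i₀, ¬(β x ∈ Φ i₁ ↔ x ∈ Φ i₀)) :
    typeRank G (sigmaType Φ) = Fintype.card (Σ i, E i) / 2 + 1 :=
  haveI : ∀ i, Nonempty (E i) := fun i => Fintype.card_pos_iff.1 (by rw [hcard]; norm_num)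
  (typeRank_sigmaType_eq_iff_forall_of_forall_map_le h
    (forall_map_slotExt_le_of_pairFlip_pair h hI h01 hflip hcard hne)).2
    fun i => typeRank_eq_of_pairFlip (h i) (hflip i)

end Family

end Literature.NumberTheory.ComplexMultiplication
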